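import Literature.Geometry.Lorentzian.TangentialConnection
import Literature.Geometry.Riemannian.RoundSphere
import Literature.Geometry.Riemannian.SphericalCapNormal
import Literature.Geometry.Lorentzian.SecondFundamentalFormApply
import Literature.Geometry.Riemannian.RicciFlowScalarCurvatureProofs
import Mathlib.Analysis.Calculus.Gradient.Basic
import HarnessLib

/-!
# Mean curvature of level sets: `H = ‖∇F‖⁻¹ Σᵢ Hess F(vᵢ, vᵢ)` for the unit gradient normal
(topic `Geometry/Riemannian`)

Infrastructure for `Literature.Geometry.Riemannian.Sweeney2026_pscMeanConvex` (Sweeney 2026,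
Prop. 1.2, after Lawson–Michelsohn 1984): the bridge between the calculus idiom in which the tree
states Lawson–Michelsohn's surrounding theorem (`LawsonMichelsohn1984_surrounding`,
`MeanConvexSurrounding.lean`: "`∑ᵢ Hess F'_x(vᵢ, vᵢ) > 0` for every orthonormal `m`-frame `v` of
`ker dF'_x`") and the tree's hypersurface vocabulary (`Hypersurface.lean`: `secondFundamentalForm`
with `K_ν(v, w) = g(D_v ν, df w)`, `meanCurvature = tr_{f^*g} K`) for the FLAT metric
`euclideanMetric W` of an inner product space `W` and the unit gradient normal `∇F/‖∇F‖`
(Lawson–Michelsohn 1984, §2 (2.4)–(2.6): for `{F = t}`, `‖∇F‖ ≠ 0`, the second fundamental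
form for `ν = ∇F/‖∇F‖` is `Hess F/‖∇F‖` on tangent vectors). Everything is PROVED:

* `leviCivita_euclideanMetric_apply` — **the Levi-Civita connection of the Euclidean metric is
  the ordinary derivative**, `∇_{X₀} Y = dY_x(X₀)` (tangential Gauss formula
  `IsLeviCivita.inner_mvfderiv_cov_apply` of `TangentialConnection.lean` for `ι = id`);
* `unitGradient F = ∇F/‖∇F‖` (Mathlib's `gradient`), smooth off the critical set, of norm `1`,
  with `⟪d(unitGradient F)_x a, b⟫ = ‖∇F‖⁻¹ Hess F_x(a, b)` for `b ∈ ker dF_x`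
  (`inner_fderiv_unitGradient`; `inner_fderiv_gradient`: `⟪d(∇F) a, b⟫ = Hess F(a, b)`,
  Mathlib's `iteratedFDeriv ℝ 2 F x ![a, b]`);
* `secondFundamentalForm_unitGradient` — for `f : N → W` mapping into a level of `F` to first
  order at `y` (`dF(df w) = 0`) with `∇F(f y) ≠ 0`:
  **`K(v, w) = ‖∇F‖⁻¹ Hess F(df v, df w)`**;
* `meanCurvature_unitGradient_eq_sum` — **`H(y) = ‖∇F‖⁻¹ ∑ᵢ Hess F(vᵢ, vᵢ)`** for
  `vᵢ = df bᵢ`, `b` any `f^*δ`-orthonormal basis of `T_y N` (which exists,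
  `exists_basis_isOrthonormalFrame`; then `v` is an orthonormal `m`-frame of `ker dF`);
  `meanCurvature_unitGradient_pos`: Lawson–Michelsohn's clause implies `H > 0`.

## References

* H. B. Lawson, M.-L. Michelsohn, *Embedding and surrounding with positive mean curvature*,
  Invent. Math. 77 (1984) 399–419, §2 (2.4)–(2.6), (2.12). [LawsonMichelsohn1984]
* J. M. Lee, *Introduction to Riemannian Manifolds*, 2nd ed. (2018), Prop. 5.12 (b), Example 4.9
  (the Euclidean connection). [Lee2018]
* P. Sweeney Jr., *Positive curvature conditions on contractible manifolds*, Math. Ann. (2026)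
  = arXiv:2507.15719, Prop. 1.2. [Sweeney2026]
-/

noncomputable section

open Bundle Set Function Metric Module Filter
open scoped Manifold ContDiff Topology RealInnerProductSpace Gradient

namespace Literature.Geometry.Riemannian

open Lorentzian Lorentzian.PseudoRiemannianMetric

variable {W : Type*} [NormedAddCommGroup W] [InnerProductSpace ℝ W] [FiniteDimensional ℝ W]

/-- **The Levi-Civita connection of the Euclidean metric is the ordinary derivative**: for a vector
field `Y` of class `C²` at `x` and `X₀ ∈ T_x W = W`, `∇_{X₀} Y = dY_x(X₀)`. The tangential Gauss
formula `IsLeviCivita.inner_mvfderiv_cov_apply` for the identity `ι = id : W → W`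
(`g_y(v, w) = ⟪v, w⟫`) gives `⟪∇_{X₀} Y, W₀⟫ = ⟪dY_x X₀, W₀⟫` for all `W₀`.
[cite: Lee2018, Prop. 5.12 (b) and Example 4.9] -/
theorem leviCivita_euclideanMetric_apply [(euclideanMetric W).HasLeviCivita]
    {Y : W → W} {x : W} (hY : ContMDiffAt 𝓘(ℝ, W) 𝓘(ℝ, W).tangent 2
      (fun y ↦ (TotalSpace.mk' W y (Y y) : TangentBundle 𝓘(ℝ, W) W)) x) (X₀ : W) :
    (euclideanMetric W).leviCivita Y x X₀ = mvfderiv 𝓘(ℝ, W) Y x X₀ := by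
  have hid : ContMDiff 𝓘(ℝ, W) 𝓘(ℝ, W) 2 (id : W → W) := contMDiff_id
  have hL : ∀ (y : W) (u : W), mvfderiv 𝓘(ℝ, W) (id : W → W) y u = u := fun y u ↦ by
    simp only [mvfderiv, mfderiv_id]
    rfl
  have hg : ∀ (y : W) (v w : TangentSpace 𝓘(ℝ, W) y),
      (euclideanMetric W).val y v w = ⟪mvfderiv 𝓘(ℝ, W) (id : W → W) y v,
        mvfderiv 𝓘(ℝ, W) (id : W → W) y w⟫ := fun y v w ↦ by
    rw [euclideanMetric_apply, hL, hL]
    rfl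
  have hfun : (fun y : W ↦ mvfderiv 𝓘(ℝ, W) (id : W → W) y (Y y)) = Y := funext fun y ↦ hL y (Y y)
  apply ext_inner_right ℝ
  intro W₀
  have key := (euclideanMetric W).isLeviCivita_leviCivita_holds.inner_mvfderiv_cov_apply
    hid hg hY X₀ W₀
  rw [hL, hL, hfun] at key
  exact key

/-! ### The unit gradient field of a function and the second fundamental form of its level sets -/

section Gradient

variable {F : W → ℝ}

/-- The gradient pairs to the differential: `⟪∇F(x), v⟫ = dF_x(v)`. [folklore] -/
theorem inner_gradient_eq_fderiv (F : W → ℝ) (x v : W) : ⟪∇ F x, v⟫ = fderiv ℝ F x v := by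
  rw [gradient, InnerProductSpace.toDual_symm_apply]

/-- The gradient of a smooth function is smooth. [folklore] -/
theorem contDiff_gradient (hF : ContDiff ℝ ∞ F) : ContDiff ℝ ∞ (∇ F) :=
  (InnerProductSpace.toDual ℝ W).symm.contDiff.comp (hF.fderiv_right le_rfl)

/-- The differential of the gradient is the Hessian: `⟪d(∇F)_x a, b⟫ = Hess F_x(a, b)`. [folklore] -/
theorem inner_fderiv_gradient (hF : ContDiff ℝ ∞ F) (x a b : W) :
    ⟪fderiv ℝ (∇ F) x a, b⟫ = iteratedFDeriv ℝ 2 F x ![a, b] := by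
  have h1 : HasFDerivAt (fderiv ℝ F) (fderiv ℝ (fderiv ℝ F) x) x :=
    (((hF.fderiv_right (m := ∞) le_rfl).differentiable (by simp)) x).hasFDerivAt
  have h2 : HasFDerivAt (∇ F)
      (((InnerProductSpace.toDual ℝ W).symm.toContinuousLinearEquiv :
        StrongDual ℝ W →L[ℝ] W).comp (fderiv ℝ (fderiv ℝ F) x)) x :=
    (InnerProductSpace.toDual ℝ W).symm.toContinuousLinearEquiv.hasFDerivAt.comp x h1
  rw [h2.fderiv, ContinuousLinearMap.comp_apply, iteratedFDeriv_two_apply]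
  exact InnerProductSpace.toDual_symm_apply

/-- **The unit gradient field** `∇F/‖∇F‖` (junk `0` at critical points). [folklore] -/
def unitGradient (F : W → ℝ) (x : W) : W := ‖∇ F x‖⁻¹ • ∇ F x

/-- The unit gradient has norm `1` off the critical set. [folklore] -/
theorem norm_unitGradient {x : W} (hx : ∇ F x ≠ 0) : ‖unitGradient F x‖ = 1 := by
  rw [unitGradient, norm_smul, norm_inv, norm_norm, inv_mul_cancel₀ (norm_ne_zero_iff.2 hx)]

/-- The unit gradient is smooth off the critical set. [folklore] -/
theorem contDiffAt_unitGradient (hF : ContDiff ℝ ∞ F) {x : W} (hx : ∇ F x ≠ 0) :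
    ContDiffAt ℝ ∞ (unitGradient F) x :=
  (((contDiff_gradient hF).contDiffAt.norm ℝ hx).inv (norm_ne_zero_iff.2 hx)).smul
    (contDiff_gradient hF).contDiffAt

/-- The unit gradient is orthogonal to the kernel of the differential. [folklore] -/
theorem inner_unitGradient_eq_zero {x b : W} (hb : fderiv ℝ F x b = 0) : ⟪unitGradient F x, b⟫ = 0 := by
  rw [unitGradient, inner_smul_left, inner_gradient_eq_fderiv, hb, mul_zero]

/-- **The derivative of the unit gradient, paired with vectors of `ker dF`, is the normalised
Hessian**: `⟪d(∇F/‖∇F‖)_x a, b⟫ = ‖∇F(x)‖⁻¹ Hess F_x(a, b)` for `b ∈ ker dF_x` (the term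
`d(‖∇F‖⁻¹)(a) ∇F` drops out). Lawson–Michelsohn 1984, §2 (2.4)–(2.6). [folklore] -/
theorem inner_fderiv_unitGradient (hF : ContDiff ℝ ∞ F) {x : W} (hx : ∇ F x ≠ 0) (a : W) {b : W}
    (hb : fderiv ℝ F x b = 0) :
    ⟪fderiv ℝ (unitGradient F) x a, b⟫ = ‖∇ F x‖⁻¹ * iteratedFDeriv ℝ 2 F x ![a, b] := by
  have hG : HasFDerivAt (∇ F) (fderiv ℝ (∇ F) x) x :=
    (((contDiff_gradient hF).differentiable (by simp)) x).hasFDerivAt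
  have hr : HasFDerivAt (fun y ↦ ‖∇ F y‖⁻¹) (fderiv ℝ (fun y ↦ ‖∇ F y‖⁻¹) x) x :=
    ((((contDiff_gradient hF).contDiffAt.norm ℝ hx).inv (norm_ne_zero_iff.2 hx)).differentiableAt
      (by simp)).hasFDerivAt
  have h : HasFDerivAt (unitGradient F)
      (‖∇ F x‖⁻¹ • fderiv ℝ (∇ F) x + (fderiv ℝ (fun y ↦ ‖∇ F y‖⁻¹) x).smulRight (∇ F x)) x :=
    hr.smul hG
  rw [h.fderiv]
  simp only [add_apply, smul_apply, ContinuousLinearMap.smulRight_apply, inner_add_left,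
    inner_smul_left, conj_trivial, inner_fderiv_gradient hF, inner_gradient_eq_fderiv, hb, mul_zero,
    add_zero]

end Gradient

/-! ### Level sets: second fundamental form and mean curvature for the unit gradient normal -/

section LevelSet

variable {E' : Type*} [NormedAddCommGroup E'] [NormedSpace ℝ E'] {H' : Type*} [TopologicalSpace H']
  {I' : ModelWithCorners ℝ E' H'} {N : Type*} [TopologicalSpace N] [ChartedSpace H' N]
  [IsManifold I' ∞ N] [FiniteDimensional ℝ E'] [(euclideanMetric W).HasLeviCivita] {F : W → ℝ}

omit [FiniteDimensional ℝ W] [(euclideanMetric W).HasLeviCivita] in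
/-- A smooth ambient vector field is a smooth section of `TW` (tangent bundle of the model vector
space): differentiability / `C^k` of `T% Y` at `x` from that of `Y`. [folklore] -/
theorem contMDiffAt_section_of_contDiffAt {Y : W → W} {x : W} {k : ℕ∞ω} (hY : ContDiffAt ℝ k Y x) :
    ContMDiffAt 𝓘(ℝ, W) 𝓘(ℝ, W).tangent k
      (fun y ↦ (TotalSpace.mk' W y (Y y) : TangentBundle 𝓘(ℝ, W) W)) x := by
  rw [ModelWithCorners.tangent, contMDiffAt_section]
  simp only [trivializationAt_model_space_apply]
  exact hY.contMDiffAt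

/-- **Second fundamental form of a hypersurface contained in a level set, for the unit gradient
normal**: if `f : N → W` maps into a level of `F` to first order at `y` (`dF(df w) = 0`) and
`∇F(f y) ≠ 0`, then `K(v, w) = ‖∇F‖⁻¹ Hess F(df v, df w)` (flat metric, tree convention
`K_ν(v, w) = ⟪D_v ν, df w⟫`). Lawson–Michelsohn 1984, §2 (2.4)–(2.6). [folklore] -/
theorem secondFundamentalForm_unitGradient (hF : ContDiff ℝ ∞ F) {f : N → W} {y : N}
    (hy : I'.IsInteriorPoint y) (hf : MDifferentiableAt I' 𝓘(ℝ, W) f y) (hx : ∇ F (f y) ≠ 0)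
    (hdF : ∀ w : TangentSpace I' y, fderiv ℝ F (f y) (mfderiv I' 𝓘(ℝ, W) f y w) = 0)
    (v w : TangentSpace I' y) :
    (euclideanMetric W).secondFundamentalForm I' f (fun z ↦ (unitGradient F (f z) : W)) y v w =
      ‖∇ F (f y)‖⁻¹ * iteratedFDeriv ℝ 2 F (f y)
        ![mfderiv I' 𝓘(ℝ, W) f y v, mfderiv I' 𝓘(ℝ, W) f y w] := by
  have hY2 : ContMDiffAt 𝓘(ℝ, W) 𝓘(ℝ, W).tangent 2
      (fun y ↦ (TotalSpace.mk' W y (unitGradient F y : W) : TangentBundle 𝓘(ℝ, W) W)) (f y) :=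
    contMDiffAt_section_of_contDiffAt ((contDiffAt_unitGradient hF hx).of_le
      (by exact_mod_cast (show ((2 : ℕ) : ℕ∞ω) ≤ ∞ from WithTop.coe_le_coe.mpr le_top)))
  have hY1 : MDifferentiableAt 𝓘(ℝ, W) 𝓘(ℝ, W).tangent
      (fun y ↦ (TotalSpace.mk' W y (unitGradient F y : W) : TangentBundle 𝓘(ℝ, W) W)) (f y) :=
    hY2.mdifferentiableAt (by simp)
  have hν : MDifferentiableAt I' 𝓘(ℝ, W).tangent
      (fun z ↦ (TotalSpace.mk' W (f z) (unitGradient F (f z) : W) : TangentBundle 𝓘(ℝ, W) W)) y :=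
    hY1.comp y hf
  rw [secondFundamentalForm_apply_holds hy hν v w, euclideanMetric_apply,
    normalDerivAlong_comp_eq_leviCivita (euclideanMetric W) hy hf hY1,
    leviCivita_euclideanMetric_apply hY2]
  change ⟪mfderiv 𝓘(ℝ, W) 𝓘(ℝ, W) (unitGradient F) (f y) (mfderiv I' 𝓘(ℝ, W) f y v),
    mfderiv I' 𝓘(ℝ, W) f y w⟫ = _
  rw [mfderiv_eq_fderiv]
  exact inner_fderiv_unitGradient hF hx _ (hdF w)

/-- **Mean curvature of a hypersurface inside a level set, for the unit gradient normal**: with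
`b` an `f^*δ`-orthonormal basis of `T_y N` (so `vᵢ = df bᵢ` is an orthonormal `m`-frame of
`ker dF`), `H(y) = ‖∇F‖⁻¹ ∑ᵢ Hess F(vᵢ, vᵢ)` — the quantity whose positivity is the conclusion of
Lawson–Michelsohn's surrounding theorem (`LawsonMichelsohn1984_surrounding`). [folklore] -/
theorem meanCurvature_unitGradient_eq_sum (hF : ContDiff ℝ ∞ F) {f : N → W}
    (hpb : contMDiff_pullbackBilin 𝓘(ℝ, W) W I' N ∞) (hf : (euclideanMetric W).IsSpacelikeImmersion I' f)
    {y : N} (hy : I'.IsInteriorPoint y) (hx : ∇ F (f y) ≠ 0)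
    (hdF : ∀ w : TangentSpace I' y, fderiv ℝ F (f y) (mfderiv I' 𝓘(ℝ, W) f y w) = 0)
    {m : ℕ} (hm : Module.finrank ℝ E' = m) :
    ∃ b : Module.Basis (Fin m) ℝ (TangentSpace I' y),
      Orthonormal ℝ (fun i ↦ mvfderiv I' f y (b i)) ∧
      (∀ i, fderiv ℝ F (f y) (mvfderiv I' f y (b i)) = 0) ∧
      (euclideanMetric W).meanCurvature f hpb hf (fun z ↦ (unitGradient F (f z) : W)) y =
        ‖∇ F (f y)‖⁻¹ * ∑ i, iteratedFDeriv ℝ 2 F (f y) ![mvfderiv I' f y (b i), mvfderiv I' f y (b i)] := by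
  set g' := (euclideanMetric W).inducedMetric f hpb hf with hg'
  have hval : ∀ v w : TangentSpace I' y, g'.val y v w = ⟪mvfderiv I' f y v, mvfderiv I' f y w⟫ :=
    fun v w ↦ by
    rw [hg', inducedMetric_val, inducedBilin_apply, euclideanMetric_apply]
    rfl
  have hpos : ∀ v : TangentSpace I' y, v ≠ 0 → 0 < g'.val y v v :=
    fun v hv ↦ isRiemannian_inducedMetric _ _ hpb hf y v hv
  obtain ⟨b, hb⟩ := g'.exists_basis_isOrthonormalFrame hpos hm
  have hfd : MDifferentiableAt I' 𝓘(ℝ, W) f y := (hf.contMDiff y).mdifferentiableAt (by simp)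
  refine ⟨b, ?_, fun i ↦ hdF _, ?_⟩
  · rw [orthonormal_iff_ite]
    intro i j
    rw [← hval]
    by_cases hij : i = j
    · subst hij; simp [hb.1 i]
    · simp [hb.2 i j hij, hij]
  · rw [meanCurvature, g'.trace_eq_sum_of_isOrthonormalFrame b hb, Finset.mul_sum]
    exact Finset.sum_congr rfl fun i _ ↦ secondFundamentalForm_unitGradient hF hy hfd hx hdF _ _

/-- Hence **positivity of the mean curvature from Lawson–Michelsohn's Hessian clause**: if
`∑ᵢ Hess F(vᵢ, vᵢ) > 0` for every orthonormal `m`-frame `v` of `ker dF` at `f y`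
(`m = dim N`), then `H(y) > 0` for the unit gradient normal. [folklore] -/
theorem meanCurvature_unitGradient_pos (hF : ContDiff ℝ ∞ F) {f : N → W}
    (hpb : contMDiff_pullbackBilin 𝓘(ℝ, W) W I' N ∞) (hf : (euclideanMetric W).IsSpacelikeImmersion I' f)
    {y : N} (hy : I'.IsInteriorPoint y) (hx : ∇ F (f y) ≠ 0)
    (hdF : ∀ w : TangentSpace I' y, fderiv ℝ F (f y) (mfderiv I' 𝓘(ℝ, W) f y w) = 0)
    {m : ℕ} (hm : Module.finrank ℝ E' = m)
    (hH : ∀ v : Fin m → W, Orthonormal ℝ v → (∀ i, fderiv ℝ F (f y) (v i) = 0) →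
      0 < ∑ i, iteratedFDeriv ℝ 2 F (f y) ![v i, v i]) :
    0 < (euclideanMetric W).meanCurvature f hpb hf (fun z ↦ (unitGradient F (f z) : W)) y := by
  obtain ⟨b, hbo, hbk, hH'⟩ := meanCurvature_unitGradient_eq_sum hF hpb hf hy hx hdF hm
  rw [hH']
  exact mul_pos (inv_pos.2 (norm_pos_iff.2 hx)) (hH _ hbo hbk)

end LevelSet

end Literature.Geometry.Riemannian

end
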